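import Summits.CriticalPhenomena.CardyFormulaZ2.Theorems.CardyBoundaryCoulombGasStripClusterRatesConfinedGlueTransfer
import Literature.Probability.Percolation.SlabGluing
import Literature.Probability.Percolation.LowestCrossingInterface
import Literature.Probability.Percolation.KSTPeriodicArmDualityPlanar
import HarnessLib

/-!
# The docking separator below a bottom-avoiding spanning cluster (stub `c8_dockingSeparator`, lead c8)

Support file for line `two-cluster-rate-is-stationary-gap` (crux `StripClusterRates`, stmt-CriticalPhenomena-13878),
step T1b of the end surgery. Let `R = [0,m] × [0,n]` and let `H` be the open cluster in `R` of a left-side site `x`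
joined inside `R` to the right side but to no bottom-side site. We find the lowest rows `r+1`, `r'+1` of `H` on the
two vertical sides and a DUAL-open walk of faces from the outer face `(-1, r)` to the outer face `(m, r')` through
inner faces of `R` only — the lower frontier of `H` (planar duality, Bollobás–Riordan 2006, Ch. 3, Lemma 1, in the
parity form of the tree). Call a site of `R` *below* when a lattice walk of `R` avoiding `H` joins it to the bottom
side. The bottom row is below, the top row is not (`exists_mem_support_of_crossing` against the open left–right
walk of `H`), so `KSTPeriodic.exists_faceWalk_box` gives a walk of faces from column `m` to column `-1` crossing only
edges of `R` with exactly one endpoint below; the other endpoint is in `H`, the edge is closed, its dual edge is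
dual-open (`dualEdge_sepEdge`). `exists_subwalk_inter_free` trims the walk to inner faces between its two end
faces, and on each vertical side the below sites lie under every site of `H` (`exists_mem_support_of_side_crossing`,
mirrored by `reflX 0` on the left), which identifies the end faces with the docking rows.

References: [BollobasRiordan2006] Ch. 3, Lemma 1; [KestenPTM1982] §2.2; [Nolin2008] §4.
-/
noncomputable section

open MeasureTheory Filter Topology Set
open SimpleGraph
open Literature.Probability.LatticeModels Literature.Probability.Percolation
open Summit.CriticalPhenomena.CardyFormulaZ2.Theorems.StripClusterRates.Negative (pOne pTwo rateSeqTwo rateSeqOne)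

namespace Summit.CriticalPhenomena.CardyFormulaZ2.Cruxes.StripClusterRates.TwoClusterRateIsStationaryGap

/-- A vertex of a walk other than its start is the head of one of its darts. [folklore] -/
theorem dks_exists_dart_snd_eq {V : Type*} {G : SimpleGraph V} {a b : V} (p : G.Walk a b) {z : V} (hz : z ∈ p.support) (hza : z ≠ a) :
    ∃ d ∈ p.darts, d.snd = z := by
  rw [← Walk.cons_map_snd_darts, List.mem_cons] at hz
  rcases hz with rfl | hz
  · exact absurd rfl hza
  · exact List.mem_map.1 hz

/-- A vertex of a walk other than its end is the tail of one of its darts. [folklore] -/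
theorem dks_exists_dart_fst_eq {V : Type*} {G : SimpleGraph V} {a b : V} (p : G.Walk a b) {z : V} (hz : z ∈ p.support) (hzb : z ≠ b) :
    ∃ d ∈ p.darts, d.fst = z := by
  rw [← Walk.map_fst_darts_append, List.mem_append, List.mem_singleton] at hz
  rcases hz with hz | rfl
  · exact List.mem_map.1 hz
  · exact absurd rfl hzb

/-- Mirror image of `exists_mem_support_of_side_crossing` (reflection `reflX 0`): a lattice walk in
the half-plane `{L ≤ x₀}` from `{R ≤ x₀}` to a point `e` of the column `L` meets every lattice walk
inside `[L, R] × [B, T]` joining two points of the column `L` on either side of `e`. [folklore] -/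
theorem dks_side_crossing_left {L R B T : ℤ} {s e am ap : Site 2}
    (γ : (zdGraph 2).Walk s e) (Q : (zdGraph 2).Walk am ap)
    (hγ : ∀ x ∈ γ.support, L ≤ x 0) (hs : R ≤ s 0) (he : e 0 = L)
    (hQ : ∀ x ∈ Q.support, L ≤ x 0 ∧ x 0 ≤ R ∧ B ≤ x 1 ∧ x 1 ≤ T)
    (ham : am 0 = L) (hap : ap 0 = L) (h1 : am 1 < e 1) (h2 : e 1 < ap 1) :
    ∃ x ∈ γ.support, x ∈ Q.support := by
  set φ := (reflX 0).toEmbedding.toHom with hφ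
  have hφapply : ∀ x : Site 2, φ x = reflX 0 x := fun x => rfl
  obtain ⟨z, hzγ, hzQ⟩ := exists_mem_support_of_side_crossing (L := -R) (R := -L) (B := B) (T := T)
    (γ.map φ) (Q.map φ)
    (fun x hx => by
      rw [Walk.support_map, List.mem_map] at hx
      obtain ⟨w, hw, rfl⟩ := hx
      have := hγ w hw
      rw [hφapply, reflX_apply_zero]
      omega)
    (by show (reflX 0 s) 0 ≤ -R; rw [reflX_apply_zero]; omega)
    (by show (reflX 0 e) 0 = -L; rw [reflX_apply_zero, he]; ring)
    (fun x hx => by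
      rw [Walk.support_map, List.mem_map] at hx
      obtain ⟨w, hw, rfl⟩ := hx
      have := hQ w hw
      rw [hφapply, reflX_apply_zero, reflX_apply_one]
      omega)
    (by show (reflX 0 am) 0 = -L; rw [reflX_apply_zero, ham]; ring) (by show (reflX 0 ap) 0 = -L; rw [reflX_apply_zero, hap]; ring)
    (by simpa [hφapply] using h1) (by simpa [hφapply] using h2)
  rw [Walk.support_map, List.mem_map] at hzγ hzQ
  obtain ⟨w, hw, rfl⟩ := hzγ
  obtain ⟨w', hw', hww⟩ := hzQ
  exact ⟨w, hw, (reflX 0).injective hww ▸ hw'⟩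

/-- Two sites of one column, `q ∈ H ⊆ R` and `p ∉ H`, with `p` not strictly below `q`: then `q` is
above the bottom row (no bottom-side site lies in `H`) and strictly below `p`. [folklore] -/
theorem dks_key_prelim {m n : ℕ} {H : Set (Site 2)} (hbot : ∀ z ∈ bottomSide m n, z ∉ H)
    {q p : Site 2} (hqH : q ∈ H) (hqR : q ∈ (rectangle m n : Set (Site 2))) (hpH : p ∉ H)
    (h0 : q 0 = p 0) (hle : ¬ p 1 < q 1) : 0 < q 1 ∧ q 1 < p 1 := by
  have hqR' := mem_rectangle_iff.1 (Finset.mem_coe.1 hqR)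
  refine ⟨?_, lt_of_le_of_ne (not_lt.1 hle) fun h => hpH ?_⟩
  · rcases hqR'.2.2.1.eq_or_lt with h | h
    · exact absurd hqH (hbot q (Finset.mem_filter.2 ⟨Finset.mem_coe.1 hqR, h.symm⟩))
    · exact h
  · have : q = p := Site.eq_iff_two.2 ⟨h0, h⟩
    exact this ▸ hqH

/-- A walk `W` along the bottom side followed by the reverse of a walk `A` of `R` avoiding `H` stays
in `R` and misses every walk `P` of sites of `H`. [folklore] -/
theorem dks_key_aux {m n : ℕ} {H : Set (Site 2)} (hbot : ∀ z ∈ bottomSide m n, z ∉ H)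
    {a q c b p : Site 2} {P : (zdGraph 2).Walk a q}
    (hP : ∀ z ∈ P.support, z ∈ H ∧ z ∈ (rectangle m n : Set (Site 2)))
    {W : (zdGraph 2).Walk c b} (hW : ∀ z ∈ W.support, z ∈ bottomSide m n)
    {A : (zdGraph 2).Walk p b} (hA : ∀ z ∈ A.support, z ∈ (rectangle m n : Set (Site 2)) ∧ z ∉ H) :
    (∀ z ∈ (W.append A.reverse).support, (0 : ℤ) ≤ z 0 ∧ z 0 ≤ m ∧ (0 : ℤ) ≤ z 1 ∧ z 1 ≤ n) ∧
      ∀ z ∈ P.support, z ∉ (W.append A.reverse).support := by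
  refine ⟨fun z hz => ?_, fun z hzP hz => ?_⟩ <;>
    rw [Walk.mem_support_append_iff, Walk.support_reverse, List.mem_reverse] at hz <;>
    rcases hz with hz | hz
  · exact mem_rectangle_iff.1 (Finset.mem_filter.1 (hW z hz)).1
  · exact mem_rectangle_iff.1 (Finset.mem_coe.1 (hA z hz).1)
  · exact hbot z (hW z hz) (hP z hzP).1
  · exact (hA z hz).2 (hP z hzP).1

/-- **Right column: below sites lie under the cluster.** If `P` is a lattice walk of sites of `H`
inside `R = [0,m] × [0,n]` from the left side to a site `q` of the right side, `A` a lattice walk of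
`R` avoiding `H` from a site `p` of the right side to the bottom side, and no bottom-side site lies
in `H`, then `p` is strictly below `q` (`exists_mem_support_of_side_crossing`). [folklore] -/
theorem dks_keyR {m n : ℕ} {H : Set (Site 2)} (hbot : ∀ z ∈ bottomSide m n, z ∉ H)
    {a q p b : Site 2} (P : (zdGraph 2).Walk a q)
    (hP : ∀ z ∈ P.support, z ∈ H ∧ z ∈ (rectangle m n : Set (Site 2))) (ha : a 0 = 0) (hq : q 0 = m)
    (A : (zdGraph 2).Walk p b) (hA : ∀ z ∈ A.support, z ∈ (rectangle m n : Set (Site 2)) ∧ z ∉ H)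
    (hb : b ∈ bottomSide m n) (hp : p 0 = m) : p 1 < q 1 := by
  by_contra hle
  have hqH := hP q P.end_mem_support
  obtain ⟨hq1, hlt⟩ := dks_key_prelim hbot hqH.1 hqH.2 (hA p A.start_mem_support).2 (by rw [hq, hp]) hle
  have hb' := Finset.mem_filter.1 hb
  have hbR := mem_rectangle_iff.1 hb'.1
  obtain ⟨W, hW⟩ := KSTPeriodic.exists_walk_row (p := pt m 0) (q := b) (by rw [hb'.2]; simp) (by simpa using hbR.2.1)
  have hWb : ∀ z ∈ W.support, z ∈ bottomSide m n := fun z hz => by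
    have := hW z hz
    simp only [Matrix.cons_val_zero] at this
    refine Finset.mem_filter.2 ⟨mem_rectangle_iff.2 ⟨?_, ?_, ?_, ?_⟩, ?_⟩ <;> omega
  obtain ⟨hbox, hdis⟩ := dks_key_aux hbot hP hWb hA
  obtain ⟨z, hzP, hzQ⟩ := exists_mem_support_of_side_crossing (L := 0) (R := m) (B := 0) (T := n) P
    (W.append A.reverse) (fun z hz => (mem_rectangle_iff.1 (Finset.mem_coe.1 (hP z hz).2)).2.1)
    (by rw [ha]) hq hbox (by simp) hp (by simpa using hq1) hlt
  exact hdis z hzP hzQ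

/-- **Left column: below sites lie under the cluster** (mirror image of `dks_keyR`, the walk of
`H` now coming from the right side). [folklore] -/
theorem dks_keyL {m n : ℕ} {H : Set (Site 2)} (hbot : ∀ z ∈ bottomSide m n, z ∉ H)
    {a q p b : Site 2} (P : (zdGraph 2).Walk a q)
    (hP : ∀ z ∈ P.support, z ∈ H ∧ z ∈ (rectangle m n : Set (Site 2))) (ha : a 0 = m) (hq : q 0 = 0)
    (A : (zdGraph 2).Walk p b) (hA : ∀ z ∈ A.support, z ∈ (rectangle m n : Set (Site 2)) ∧ z ∉ H)
    (hb : b ∈ bottomSide m n) (hp : p 0 = 0) : p 1 < q 1 := by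
  by_contra hle
  have hqH := hP q P.end_mem_support
  obtain ⟨hq1, hlt⟩ := dks_key_prelim hbot hqH.1 hqH.2 (hA p A.start_mem_support).2 (by rw [hq, hp]) hle
  have hb' := Finset.mem_filter.1 hb
  have hbR := mem_rectangle_iff.1 hb'.1
  obtain ⟨W, hW⟩ := KSTPeriodic.exists_walk_row (p := b) (q := pt 0 0) (by rw [hb'.2]; simp) (by simpa using hbR.1)
  have hWb : ∀ z ∈ W.reverse.support, z ∈ bottomSide m n := fun z hz => by
    rw [Walk.support_reverse, List.mem_reverse] at hz
    have := hW z hz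
    simp only [Matrix.cons_val_one, Matrix.cons_val_fin_one, Matrix.cons_val_zero] at this
    refine Finset.mem_filter.2 ⟨mem_rectangle_iff.2 ⟨?_, ?_, ?_, ?_⟩, ?_⟩ <;> omega
  obtain ⟨hbox, hdis⟩ := dks_key_aux hbot hP hWb hA
  obtain ⟨z, hzP, hzQ⟩ := dks_side_crossing_left (L := 0) (R := m) (B := 0) (T := n) P
    (W.reverse.append A.reverse) (fun z hz => (mem_rectangle_iff.1 (Finset.mem_coe.1 (hP z hz).2)).1)
    (by rw [ha]) hq hbox (by simp) hp (by simpa using hq1) hlt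
  exact hdis z hzP hzQ

/-- **A colour-changing edge of `R` is a closed edge between a below site and a site of `H`.**
Here `H` is closed under open steps inside `R`, `Bl` ("below") excludes `H` and propagates to
non-`H` neighbours inside `R`. [folklore] -/
theorem dks_edge {m n : ℕ} {ω : BondConfig (Site 2)} {H : Set (Site 2)} {Bl : Site 2 → Prop}
    (hcl : ∀ p q : Site 2, p ∈ H → q ∈ (rectangle m n : Set (Site 2)) → s(p, q) ∈ ω → p ≠ q → q ∈ H)
    (hBlH : ∀ v, Bl v → v ∉ H)
    (hBladj : ∀ u v, Bl v → u ∈ (rectangle m n : Set (Site 2)) → u ∉ H → (zdGraph 2).Adj u v → Bl u)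
    {lo hi : Site 2} (hadj : (zdGraph 2).Adj lo hi)
    (hlo : lo ∈ (rectangle m n : Set (Site 2))) (hhi : hi ∈ (rectangle m n : Set (Site 2)))
    (hc : Bl lo ↔ ¬ Bl hi) :
    s(lo, hi) ∉ ω ∧ ((Bl lo ∧ hi ∈ H) ∨ (lo ∈ H ∧ Bl hi)) := by
  have hne : lo ≠ hi := hadj.ne
  by_cases hBlo : Bl lo
  · have hBhi : ¬ Bl hi := hc.1 hBlo
    have hloH : lo ∉ H := hBlH lo hBlo
    have hhiH : hi ∈ H := by_contra fun h => hBhi (hBladj hi lo hBlo hhi h hadj.symm)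
    exact ⟨fun he => hloH (hcl hi lo hhiH hlo (by rw [Sym2.eq_swap]; exact he) hne.symm),
      Or.inl ⟨hBlo, hhiH⟩⟩
  · have hBhi : Bl hi := by_contra fun h => hBlo (hc.2 h)
    have hhiH : hi ∉ H := hBlH hi hBhi
    have hloH : lo ∈ H := by_contra fun h => hBlo (hBladj lo hi hBhi hlo h hadj)
    exact ⟨fun he => hhiH (hcl lo hi hloH hhi he hne), Or.inr ⟨hloH, hBhi⟩⟩

/-- The dual edge joining two adjacent faces is dual-open as soon as the primal edge separating
them is closed (lattice configurations; `dualEdge_sepEdge`, `dualEdge_injOn_holds`). [folklore] -/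
theorem dks_mem_dualConfig {ω : BondConfig (Site 2)} (hω : ω ⊆ (zdGraph 2).edgeSet) {z z' : Site 2}
    (hadj : (zdGraph 2).Adj z z') (hsep : sepEdge z z' ∉ ω) : s(z, z') ∈ dualConfig ω := by
  rw [mem_dualConfig_iff]
  refine ⟨(zdGraph 2).mem_edgeSet.2 hadj, fun e' he' heq => ?_⟩
  rw [← dualEdge_sepEdge hadj] at heq
  have := dualEdge_injOn_holds (hω he') (sepEdge_mem_edgeSet hadj) heq
  exact hsep (this ▸ he')

/-- **The frontier face walk.** Under the closure hypotheses on `H` and `Bl` of `dks_edge`, if the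
bottom row of `R = [0,m] × [0,n]` is below and the top row is not, there is a walk of faces from a
face `a'` of the column `m` to a face `b'` of the column `-1`, inside `[-1,m] × [0,n-1]`, whose
darts never start in column `-1` and never end in column `m`, each crossing a closed edge of `R`
joining a below site to a site of `H`, so that each of its steps is a dual-open dual edge.
(`KSTPeriodic.exists_faceWalk_box` + `exists_subwalk_inter_free`.) [folklore] -/
theorem dks_frontier {m n : ℕ} {ω : BondConfig (Site 2)} (hω : ω ⊆ (zdGraph 2).edgeSet)
    {H : Set (Site 2)} {Bl : Site 2 → Prop}
    (hcl : ∀ p q : Site 2, p ∈ H → q ∈ (rectangle m n : Set (Site 2)) → s(p, q) ∈ ω → p ≠ q → q ∈ H)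
    (hBlH : ∀ v, Bl v → v ∉ H)
    (hBladj : ∀ u v, Bl v → u ∈ (rectangle m n : Set (Site 2)) → u ∉ H → (zdGraph 2).Adj u v → Bl u)
    (hBbot : ∀ v : Site 2, 0 ≤ v 0 → v 0 ≤ m → v 1 = 0 → Bl v)
    (hBtop : ∀ v : Site 2, 0 ≤ v 0 → v 0 ≤ m → v 1 = n → ¬ Bl v) :
    ∃ (a' b' : Site 2) (q : (zdGraph 2).Walk a' b'), a' 0 = m ∧ b' 0 = -1 ∧
      (∀ z ∈ q.support, -1 ≤ z 0 ∧ z 0 ≤ m ∧ 0 ≤ z 1 ∧ z 1 + 1 ≤ n) ∧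
      ∀ d ∈ q.darts, d.fst 0 ≠ -1 ∧ d.snd 0 ≠ m ∧ s(d.fst, d.snd) ∈ dualConfig ω ∧
        ((Bl (sepLo d.fst d.snd) ∧ sepHi d.fst d.snd ∈ H) ∨ (sepLo d.fst d.snd ∈ H ∧ Bl (sepHi d.fst d.snd))) := by
  obtain ⟨u, w, q, hu, hw, hqs, hqd⟩ := KSTPeriodic.exists_faceWalk_box Bl (L := 0) (R := m) (B := 0)
    (T := n) (by positivity) (by positivity) hBbot hBtop
  obtain ⟨a', ha', b', hb', q', hq'd, hq'B, hq'A⟩ := exists_subwalk_inter_free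
    (A := {z : Site 2 | z 0 = m}) (B := {z : Site 2 | z 0 = -1}) q hu (by show w 0 = -1; rw [hw]; ring)
  have hsub : ∀ z ∈ q'.support, z ∈ q.support := fun z hz => by
    by_cases hza : z = a'
    · have hne : z ≠ b' := fun h => by
        have h1 : a' 0 = (m : ℤ) := ha'; have h2 : b' 0 = -1 := hb'; rw [← hza, h] at h1; omega
      obtain ⟨d, hd, rfl⟩ := dks_exists_dart_fst_eq q' hz hne
      exact q.dart_fst_mem_support_of_mem_darts (hq'd d hd)
    · obtain ⟨d, hd, rfl⟩ := dks_exists_dart_snd_eq q' hz hza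
      exact q.dart_snd_mem_support_of_mem_darts (hq'd d hd)
  refine ⟨a', b', q', ha', hb', fun z hz => ?_, fun d hd => ⟨hq'B d hd, hq'A d hd, ?_⟩⟩
  · have := hqs z (hsub z hz); omega
  · obtain ⟨hbox, hcol⟩ := hqd d (hq'd d hd)
    have hadj' : (zdGraph 2).Adj (sepLo d.fst d.snd) (sepHi d.fst d.snd) :=
      (zdGraph 2).mem_edgeSet.1 (sepEdge_mem_edgeSet d.adj)
    have hloR : sepLo d.fst d.snd ∈ (rectangle m n : Set (Site 2)) :=
      Finset.mem_coe.2 (mem_rectangle_iff.2 (hbox (sepLo d.fst d.snd) (Sym2.mem_mk_left _ _)))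
    have hhiR : sepHi d.fst d.snd ∈ (rectangle m n : Set (Site 2)) :=
      Finset.mem_coe.2 (mem_rectangle_iff.2 (hbox (sepHi d.fst d.snd) (Sym2.mem_mk_right _ _)))
    obtain ⟨hclosed, hor⟩ := dks_edge hcl hBlH hBladj hadj' hloR hhiR hcol
    exact ⟨dks_mem_dualConfig hω d.adj hclosed, hor⟩

/-- **Docking separator** (T1b of line `two-cluster-rate-is-stationary-gap`). For a lattice
configuration `ω` and a left-side site `x` of `R = [0,m] × [0,n]` joined inside `R` to the right
side by an open path but to no bottom-side site: the docking rows `r+1 = min {j | (0,j) ↔ x in R}`,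
`r'+1 = min {j | (m,j) ↔ x in R}` exist, and a dual-open walk of faces joins the outer face
`(-1, r)` to the outer face `(m, r')` through inner faces of `R` only (the lower frontier of the
cluster of `x`; planar duality, Bollobás–Riordan 2006, Ch. 3, Lemma 1, via the parity lemma
`KSTPeriodic.exists_faceWalk_box` and the crossing lemmas `exists_mem_support_of_crossing`,
`exists_mem_support_of_side_crossing`). [cite: BollobasRiordan2006, Ch. 3, Lemma 1] -/
theorem c8_dockingSeparator : ∀ (m n : ℕ) (ω : BondConfig (Site 2)), 1 ≤ m → ω ⊆ (zdGraph 2).edgeSet →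
    ∀ x ∈ (leftSide m n : Set (Site 2)), ∀ y ∈ (rightSide m n : Set (Site 2)), ω ∈ openConnIn (rectangle m n : Set (Site 2)) x y →
    (∀ z ∈ (bottomSide m n : Set (Site 2)), ω ∉ openConnIn (rectangle m n : Set (Site 2)) x z) →
    ∃ r r' : ℕ, r + 1 ≤ n ∧ r' + 1 ≤ n ∧
      ω ∈ openConnIn (rectangle m n : Set (Site 2)) x (pt 0 ((r : ℤ) + 1)) ∧
      ω ∈ openConnIn (rectangle m n : Set (Site 2)) x (pt m ((r' : ℤ) + 1)) ∧
      (∀ z ∈ (leftSide m n : Set (Site 2)), ω ∈ openConnIn (rectangle m n : Set (Site 2)) x z → (r : ℤ) + 1 ≤ z 1) ∧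
      (∀ z ∈ (rightSide m n : Set (Site 2)), ω ∈ openConnIn (rectangle m n : Set (Site 2)) x z → (r' : ℤ) + 1 ≤ z 1) ∧
      dualConfig ω ∈ openCrossing {z : Site 2 | (0 ≤ z 0 ∧ z 0 + 1 ≤ (m : ℤ) ∧ 0 ≤ z 1 ∧ z 1 + 1 ≤ (n : ℤ)) ∨ z = pt (-1) r ∨ z = pt m r'} {pt (-1) r} {pt m r'} := by
  intro m n ω _hm hω x hx y hy hxy hbot
  classical
  -- the open cluster `H` of `x` in `R`: closure properties and open walks inside it
  set H : Set (Site 2) := {v | ω ∈ openConnIn (rectangle m n : Set (Site 2)) x v} with hH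
  have hx0 : x 0 = 0 := (Finset.mem_filter.1 (Finset.mem_coe.1 hx)).2
  have hy0 : y 0 = m := (Finset.mem_filter.1 (Finset.mem_coe.1 hy)).2
  have hyH : y ∈ H := hxy
  have hHR : ∀ v ∈ H, v ∈ (rectangle m n : Set (Site 2)) := fun v hv => hv.2.1
  have hcl : ∀ p q : Site 2, p ∈ H → q ∈ (rectangle m n : Set (Site 2)) → s(p, q) ∈ ω → p ≠ q → q ∈ H :=
    fun p q hp hq he hne => PlanarDuality.openConnIn_trans hp (openConnIn_of_adj (hHR p hp) hq he hne)
  have hbotH : ∀ z ∈ bottomSide m n, z ∉ H := fun z hz hzH => hbot z (Finset.mem_coe.2 hz) hzH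
  have hwalk : ∀ v ∈ H, ∃ P : (zdGraph 2).Walk x v, ∀ z ∈ P.support, z ∈ H ∧ z ∈ (rectangle m n : Set (Site 2)) := by
    intro v hv
    obtain ⟨P, hPS, hPω⟩ := exists_walk_of_mem_openConnIn hω hv
    exact ⟨P, fun z hz => ⟨mem_openConnIn_of_mem_support P hPS hPω hz, hPS z hz⟩⟩
  have hwalk' : ∀ v ∈ H, ∃ P : (zdGraph 2).Walk y v, ∀ z ∈ P.support, z ∈ H ∧ z ∈ (rectangle m n : Set (Site 2)) := by
    intro v hv
    have hyv : ω ∈ openConnIn (rectangle m n : Set (Site 2)) y v :=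
      PlanarDuality.openConnIn_trans (by rw [openConnIn_comm]; exact hxy) hv
    obtain ⟨P, hPS, hPω⟩ := exists_walk_of_mem_openConnIn hω hyv
    exact ⟨P, fun z hz =>
      ⟨PlanarDuality.openConnIn_trans hxy (mem_openConnIn_of_mem_support P hPS hPω hz), hPS z hz⟩⟩
  -- the colouring "below"
  set Bl : Site 2 → Prop := fun v => ∃ b ∈ bottomSide m n, ∃ A : (zdGraph 2).Walk v b,
    ∀ z ∈ A.support, z ∈ (rectangle m n : Set (Site 2)) ∧ z ∉ H with hBl
  have hBlout : ∀ v, Bl v → ∃ b ∈ bottomSide m n, ∃ A : (zdGraph 2).Walk v b,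
      ∀ z ∈ A.support, z ∈ (rectangle m n : Set (Site 2)) ∧ z ∉ H := fun v hv => hv
  have hBlH : ∀ v, Bl v → v ∉ H := by
    rintro v ⟨b, hb, A, hA⟩; exact (hA v A.start_mem_support).2
  have hBladj : ∀ u v, Bl v → u ∈ (rectangle m n : Set (Site 2)) → u ∉ H → (zdGraph 2).Adj u v → Bl u := by
    rintro u v ⟨b, hb, A, hA⟩ hu huH hadj
    refine ⟨b, hb, Walk.cons hadj A, fun z hz => ?_⟩
    rw [Walk.support_cons, List.mem_cons] at hz
    rcases hz with rfl | hz
    · exact ⟨hu, huH⟩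
    · exact hA z hz
  have hBbot : ∀ v : Site 2, 0 ≤ v 0 → v 0 ≤ m → v 1 = 0 → Bl v := by
    intro v h0 h0' h1
    have hvb : v ∈ bottomSide m n :=
      Finset.mem_filter.2 ⟨mem_rectangle_iff.2 ⟨h0, h0', by omega, by omega⟩, h1⟩
    refine ⟨v, hvb, Walk.nil, fun z hz => ?_⟩
    rw [Walk.support_nil, List.mem_singleton] at hz
    subst hz
    exact ⟨Finset.mem_coe.2 (Finset.mem_filter.1 hvb).1, hbotH _ hvb⟩
  have hBtop : ∀ v : Site 2, 0 ≤ v 0 → v 0 ≤ m → v 1 = n → ¬ Bl v := by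
    rintro v - - h1 ⟨b, hb, A, hA⟩
    -- a walk of `R` from the top row to the bottom row avoiding `H` misses the open crossing of `H`
    obtain ⟨P, hP⟩ := hwalk y hyH
    obtain ⟨z, hzP, hzA⟩ := exists_mem_support_of_crossing (L := 0) (R := m) (B := 0) (T := n) P A.reverse
      (fun z hz => mem_rectangle_iff.1 (Finset.mem_coe.1 (hP z hz).2))
      (fun z hz => by
        rw [Walk.support_reverse, List.mem_reverse] at hz
        exact mem_rectangle_iff.1 (Finset.mem_coe.1 (hA z hz).1))
      hx0 hy0 (Finset.mem_filter.1 hb).2 h1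
    rw [Walk.support_reverse, List.mem_reverse] at hzA
    exact (hA z hzA).2 (hP z hzP).1
  -- the trimmed frontier walk
  obtain ⟨a', b', q, ha', hb', hqs, hqd⟩ := dks_frontier hω hcl hBlH hBladj hBbot hBtop
  have hne : a' ≠ b' := fun h => by rw [h, hb'] at ha'; omega
  have ha'q := hqs a' q.start_mem_support
  have hb'q := hqs b' q.end_mem_support
  -- its right end: `a'` is below and `a' + e₁ ∈ H`
  obtain ⟨hBa, haH⟩ : Bl a' ∧ a' + Pi.single 1 1 ∈ H := by
    obtain ⟨d, hd, hda⟩ := dks_exists_dart_fst_eq q q.start_mem_support hne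
    obtain ⟨-, hsnd, -, hor⟩ := hqd d hd
    have hsndq := hqs d.snd (q.dart_snd_mem_support_of_mem_darts hd)
    have hstep : d.snd = a' - Pi.single 0 1 := by
      rcases stepKind_of_adj d.adj with ⟨h0, h1⟩ | ⟨h0, h1⟩ | ⟨h1, h0⟩ | ⟨h1, h0⟩ <;>
        rw [hda] at h0 h1 <;> rw [Site.eq_iff_two] <;> simp <;> omega
    rw [hda, hstep, sepLo_sub_e0, sepHi_sub_e0] at hor
    rcases hor with h | ⟨haH, hBl'⟩
    · exact h
    · exfalso
      obtain ⟨P, hP⟩ := hwalk a' haH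
      obtain ⟨b, hb, A, hA⟩ := hBlout _ hBl'
      have := dks_keyR hbotH P hP hx0 ha' A hA hb (by simpa using ha')
      simp at this
  -- its left end: `b' + e₀` is below and `b' + e₀ + e₁ ∈ H`
  obtain ⟨hBb, hbH⟩ : Bl (b' + Pi.single 0 1) ∧ b' + Pi.single 0 1 + Pi.single 1 1 ∈ H := by
    obtain ⟨d, hd, hdb⟩ := dks_exists_dart_snd_eq q q.end_mem_support hne.symm
    obtain ⟨hfst, -, -, hor⟩ := hqd d hd
    have hfstq := hqs d.fst (q.dart_fst_mem_support_of_mem_darts hd)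
    have hstep : d.fst = b' + Pi.single 0 1 := by
      rcases stepKind_of_adj d.adj with ⟨h0, h1⟩ | ⟨h0, h1⟩ | ⟨h1, h0⟩ | ⟨h1, h0⟩ <;>
        rw [hdb] at h0 h1 <;> rw [Site.eq_iff_two] <;> simp <;> omega
    rw [hdb, hstep, sepLo_comm, sepHi_comm, sepLo_add_e0, sepHi_add_e0] at hor
    rcases hor with h | ⟨hloH, hBl'⟩
    · exact h
    · exfalso
      obtain ⟨P, hP⟩ := hwalk' _ hloH
      obtain ⟨b, hb, A, hA⟩ := hBlout _ hBl'
      have := dks_keyL hbotH P hP hy0 (by simp [hb']) A hA hb (by simp [hb'])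
      simp at this
  -- the docking rows `r = b' 1`, `r' = a' 1`
  refine ⟨(b' 1).toNat, (a' 1).toNat, ?_, ?_, ?_, ?_, ?_, ?_, ?_⟩
  · have := Int.toNat_of_nonneg hb'q.2.2.1; omega
  · have := Int.toNat_of_nonneg ha'q.2.2.1; omega
  · rw [show pt 0 ((((b' 1).toNat : ℕ) : ℤ) + 1) = b' + Pi.single 0 1 + Pi.single 1 1 by
      rw [Int.toNat_of_nonneg hb'q.2.2.1, Site.eq_iff_two]; simp [hb']]; exact hbH
  · rw [show pt m ((((a' 1).toNat : ℕ) : ℤ) + 1) = a' + Pi.single 1 1 by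
      rw [Int.toNat_of_nonneg ha'q.2.2.1, Site.eq_iff_two]; simp [ha']]; exact haH
  · intro z hz hzH
    have hz0 : z 0 = 0 := (Finset.mem_filter.1 (Finset.mem_coe.1 hz)).2
    obtain ⟨P, hP⟩ := hwalk' z hzH
    obtain ⟨b, hb, A, hA⟩ := hBlout _ hBb
    have := dks_keyL hbotH P hP hy0 hz0 A hA hb (by simp [hb'])
    simp only [Pi.add_apply, single_zero_apply_one, add_zero] at this
    rw [Int.toNat_of_nonneg hb'q.2.2.1]; omega
  · intro z hz hzH
    have hz0 : z 0 = m := (Finset.mem_filter.1 (Finset.mem_coe.1 hz)).2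
    obtain ⟨P, hP⟩ := hwalk z hzH
    obtain ⟨b, hb, A, hA⟩ := hBlout _ hBa
    have := dks_keyR hbotH P hP hx0 hz0 A hA hb ha'
    rw [Int.toNat_of_nonneg ha'q.2.2.1]; omega
  · -- the dual-open face walk from `pt (-1) r = b'` to `pt m r' = a'`
    rw [show pt (-1) ((((b' 1).toNat : ℕ) : ℤ)) = b' by rw [Int.toNat_of_nonneg hb'q.2.2.1, Site.eq_iff_two]; simp [hb'],
      show pt m ((((a' 1).toNat : ℕ) : ℤ)) = a' by rw [Int.toNat_of_nonneg ha'q.2.2.1, Site.eq_iff_two]; simp [ha']]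
    refine ⟨b', Set.mem_singleton _, a', Set.mem_singleton _, ?_⟩
    rw [openConnIn_comm]
    refine mem_openConnIn_of_walk q (fun z hz => ?_) (fun e he => ?_)
    · by_cases hza : z = a'
      · exact Or.inr (Or.inr hza)
      by_cases hzb : z = b'
      · exact Or.inr (Or.inl hzb)
      obtain ⟨d, hd, hdz⟩ := dks_exists_dart_snd_eq q hz hza
      obtain ⟨d', hd', hd'z⟩ := dks_exists_dart_fst_eq q hz hzb
      have h1 := (hqd d hd).2.1
      have h2 := (hqd d' hd').1
      rw [hdz] at h1; rw [hd'z] at h2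
      have := hqs z hz
      exact Or.inl ⟨by omega, by omega, this.2.2.1, this.2.2.2⟩
    · rw [Walk.edges, List.mem_map] at he
      obtain ⟨d, hd, rfl⟩ := he
      exact (hqd d hd).2.2.1

end Summit.CriticalPhenomena.CardyFormulaZ2.Cruxes.StripClusterRates.TwoClusterRateIsStationaryGap

end
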